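import Mathlib
import Literature.Analysis.DeBrangesSpaces.HalfPlaneCauchy

/-!
HONEST FRAMING: exact (Metropolis-corrected) sampling algorithms for lattice gauge theory; figures
of merit are autocorrelation/cost numbers at stated couplings and volumes; no continuum-physics
claim.

# FisherStaircaseLength — THEOREM S, length form (THEORY-1.md §31.1 (iii), remarks (a)–(b)):
the number of stages of an `η`-margined staircase is at least the QUASIHYPERBOLIC LENGTH of the
coupling interval measured with ANY 1-Lipschitz gauge `ρ` dominating the steps — in particular
with `ρ = dist(·, F)` for the whole zero set `F` — and the greedy staircase is optimal

Proposed tree path: `Summits/Ventures/LatticeQCDFlow/TrivializingMaps/FisherStaircaseLength.lean`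
(OURS — venture-side, never `Literature/`). PURE real analysis: imports only `Mathlib` and the
landed identity `Literature.Analysis.DeBrangesSpaces.norm_ofReal_sub_sq`; independent of
`FisherStaircaseChain` / `FisherStaircase` (which dock the hypothesis
`Δ_k ≤ (1-η)·|x_k - s₀|` for every Fisher zero `s₀` of `Z_L` — `Staircase.step_le_of_stage_summable`
— and hence, by `Staircase.step_le_mul_infDist` below, `Δ_k ≤ (1-η)·dist(x_k, F)` for the zero
set `F`). Cell `lqcd-flow` (pub-lqcd), unit `pub-lqcd-theory1-g19`, 2026-08-22.

Setting. A gauge `ρ : ℝ → ℝ` with `ρ t ≤ ρ t' + |t - t'|` (1-Lipschitz) and `ρ > 0`; a real chain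
`x : ℕ → ℝ` whose steps satisfy `x (k+1) - x k ≤ (1 - η) * ρ (x k)` for `k < K`, `0 < η ≤ 1`. The
model case is `ρ t = infDist (t : ℂ) F` for a closed set `F ⊂ ℂ ∖ ℝ` (the Fisher zeros of a
partition function positive on the real axis), and `ρ t = ‖(t : ℂ) - z‖` for a single zero `z`.

Results (all `[ours]`; the metric notions are classical — Gehring–Palka 1976 quasihyperbolic
length `∫ |dz|/d(z, ∂Ω)`):
* `Staircase.fullStep_mono`: `t ↦ t + (1-η)ρ(t)` is monotone (`0 ≤ η ≤ 1`).
* **`Staircase.le_greedy`** (optimality of the greedy staircase): any admissible chain is dominated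
  termwise by the chain taking the full admissible step `y (k+1) ≥ y k + (1-η)ρ(y k)` from
  `y 0 ≥ x 0`; hence the greedy staircase reaches every coupling in the minimal number of stages.
* `Staircase.integral_inv_le_log_of_step`: one admissible step has `ρ`-length
  `∫_{x_k}^{x_{k+1}} dt/ρ(t) ≤ log(1/η)`.
* **`Staircase.integral_inv_le_mul_log`**: `∫_{x₀}^{x_K} dt/ρ(t) ≤ K · log(1/η)` — the stage
  count is at least the `ρ`-quasihyperbolic length of `[x₀, x_K]` over `log(1/η)`.
* `Staircase.step_le_mul_infDist`, **`Staircase.integral_inv_infDist_le_mul_log`**: the same with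
  `ρ = dist(·, F)`, `F` closed, nonempty, without real points, from the per-point hypotheses
  `Δ_k ≤ (1-η)‖x_k - s₀‖`, `s₀ ∈ F` — the SEVERAL-ZEROS form of THEOREM S
  (`K log(1/η) ≥ ∫_{x₀}^{x_K} dx/dist(x, F)`, which dominates every single-zero length).
* `Staircase.integral_inv_norm_ofReal_sub`: the single-zero length in closed form,
  `∫_a^b dt/‖t - z‖ = arsinh((b - Re z)/|Im z|) - arsinh((a - Re z)/|Im z|)` (`Im z ≠ 0`) — the
  bridge to the `arsinh` form `Staircase.arsinh_sub_arsinh_le` of `FisherStaircase`.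
NOT claimed: anything about a specific partition function (the docking lives in
`FisherStaircase`), any zero location, any cost statement.
-/

open MeasureTheory Set Metric intervalIntegral

namespace Summit.Ventures.LatticeQCDFlow.TrivializingMaps

namespace Staircase

/-! ## §1. The step map is monotone; the greedy staircase is optimal -/

/-- For a 1-Lipschitz gauge `ρ` and `0 ≤ η ≤ 1` the full-step map `t ↦ t + (1-η)ρ(t)` is
monotone. [ours] -/
theorem fullStep_mono {ρ : ℝ → ℝ} (hρ : ∀ t t', ρ t ≤ ρ t' + |t - t'|) {η : ℝ} (hη0 : 0 ≤ η)
    (hη1 : η ≤ 1) {s t : ℝ} (hst : s ≤ t) :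
    s + (1 - η) * ρ s ≤ t + (1 - η) * ρ t := by
  have h1 : ρ s ≤ ρ t + (t - s) := by
    have := hρ s t
    rwa [abs_of_nonpos (by linarith), neg_sub] at this
  have h2 : (1 - η) * ρ s ≤ (1 - η) * (ρ t + (t - s)) :=
    mul_le_mul_of_nonneg_left h1 (by linarith)
  nlinarith

/-- **Optimality of the greedy staircase.** If `x` is admissible (`x (k+1) ≤ x k + (1-η)ρ(x k)`)
and `y` takes at least the full admissible step (`y k + (1-η)ρ(y k) ≤ y (k+1)`) from `x 0 ≤ y 0`,
then `x K ≤ y K`: no admissible staircase reaches farther than the greedy one in `K` stages, so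
the greedy staircase realises the minimal stage count to every coupling. [ours] -/
theorem le_greedy {ρ : ℝ → ℝ} (hρ : ∀ t t', ρ t ≤ ρ t' + |t - t'|) {η : ℝ} (hη0 : 0 ≤ η)
    (hη1 : η ≤ 1) {x y : ℕ → ℝ} {K : ℕ} (hx : ∀ k < K, x (k + 1) ≤ x k + (1 - η) * ρ (x k))
    (hy : ∀ k < K, y k + (1 - η) * ρ (y k) ≤ y (k + 1)) (h0 : x 0 ≤ y 0) : x K ≤ y K := by
  induction K with
  | zero => exact h0
  | succ K ih =>
    have hK : x K ≤ y K :=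
      ih (fun k hk => hx k (Nat.lt_succ_of_lt hk)) (fun k hk => hy k (Nat.lt_succ_of_lt hk))
    calc x (K + 1) ≤ x K + (1 - η) * ρ (x K) := hx K (Nat.lt_succ_self K)
      _ ≤ y K + (1 - η) * ρ (y K) := fullStep_mono hρ hη0 hη1 hK
      _ ≤ y (K + 1) := hy K (Nat.lt_succ_self K)

/-! ## §2. Quasihyperbolic length of an admissible staircase -/

/-- A 1-Lipschitz real gauge is continuous. -/
theorem continuous_of_le_add_abs {ρ : ℝ → ℝ} (hρ : ∀ t t', ρ t ≤ ρ t' + |t - t'|) :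
    Continuous ρ :=
  (LipschitzWith.of_le_add (f := ρ) fun t t' => by rw [Real.dist_eq]; exact hρ t t').continuous

/-- **One admissible step has `ρ`-length at most `log(1/η)`.** If `ρ` is 1-Lipschitz and positive,
`0 < η ≤ 1` and `b - a ≤ (1-η)ρ(a)`, then `∫_a^b dt/ρ(t) ≤ log(1/η)`: on `[a, b]`,
`ρ(t) ≥ ρ(a) - (t - a)`, and `∫_a^b dt/(ρ(a) - (t - a)) = log(ρ(a)/(ρ(a) - (b - a))) ≤ log(1/η)`.
(For `b < a` the integral is nonpositive.) [ours] -/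
theorem integral_inv_le_log_of_step {ρ : ℝ → ℝ} (hρ : ∀ t t', ρ t ≤ ρ t' + |t - t'|)
    (hpos : ∀ t, 0 < ρ t) {η a b : ℝ} (hη0 : 0 < η) (hη1 : η ≤ 1)
    (hstep : b - a ≤ (1 - η) * ρ a) :
    ∫ t in a..b, (ρ t)⁻¹ ≤ Real.log (1 / η) := by
  have hcont : Continuous ρ := continuous_of_le_add_abs hρ
  have hcinv : Continuous fun t => (ρ t)⁻¹ := hcont.inv₀ fun t => (hpos t).ne'
  have hlog0 : 0 ≤ Real.log (1 / η) := by
    rw [one_div, Real.log_inv]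
    have := Real.log_nonpos hη0.le hη1
    linarith
  rcases le_or_gt a b with hab | hba
  · -- the genuine case `a ≤ b`
    set d := ρ a with hd_def
    have hd : 0 < d := hpos a
    have hΔ : b - a ≤ (1 - η) * d := hstep
    have hden : ∀ t ∈ Icc a b, η * d ≤ d + a - t := by
      intro t ht
      have := ht.2
      nlinarith
    have hdenpos : ∀ t ∈ Icc a b, 0 < d + a - t := fun t ht =>
      lt_of_lt_of_le (mul_pos hη0 hd) (hden t ht)
    -- pointwise majorant
    have hmaj : ∀ t ∈ Icc a b, (ρ t)⁻¹ ≤ (d + a - t)⁻¹ := by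
      intro t ht
      have h1 : d ≤ ρ t + (t - a) := by
        have := hρ a t
        rwa [abs_of_nonpos (by linarith [ht.1]), neg_sub] at this
      exact inv_anti₀ (hdenpos t ht) (by linarith)
    have hgcont : ContinuousOn (fun t => (d + a - t)⁻¹) (uIcc a b) := by
      rw [uIcc_of_le hab]
      exact (continuousOn_const.sub continuousOn_id).inv₀ fun t ht => (hdenpos t ht).ne'
    have hmono := intervalIntegral.integral_mono_on hab (hcinv.intervalIntegrable a b)
      (hgcont.intervalIntegrable (μ := volume)) hmaj
    -- evaluate the majorant's integral
    have heval : ∫ t in a..b, (d + a - t)⁻¹ = Real.log (d / (d + a - b)) := by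
      rw [intervalIntegral.integral_comp_sub_left (fun u => u⁻¹) (d + a), integral_inv]
      · congr 1
        rw [add_sub_cancel_right]
      · exact notMem_uIcc_of_lt (hdenpos b ⟨hab, le_rfl⟩) (by linarith)
    rw [heval] at hmono
    refine hmono.trans ?_
    -- `log (d/(d+a-b)) ≤ log (1/η)` iff `η d ≤ d + a - b`
    have hq : 0 < d + a - b := hdenpos b ⟨hab, le_rfl⟩
    rw [Real.log_le_log_iff (div_pos hd hq) (by positivity)]
    rw [div_le_div_iff₀ hq hη0]
    nlinarith [hden b ⟨hab, le_rfl⟩]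
  · -- `b < a`: the integral is nonpositive
    rw [intervalIntegral.integral_symm]
    have : 0 ≤ ∫ t in b..a, (ρ t)⁻¹ :=
      intervalIntegral.integral_nonneg hba.le fun t _ => (inv_pos.mpr (hpos t)).le
    linarith

/-- **THEOREM S, length form — the stage count is at least the `ρ`-quasihyperbolic length of the
coupling interval over `log(1/η)`.** For a positive 1-Lipschitz gauge `ρ`, `0 < η ≤ 1`, and a real
chain with `x (k+1) - x k ≤ (1-η)ρ(x k)` for `k < K`:
`∫_{x₀}^{x_K} dt/ρ(t) ≤ K · log(1/η)`. No monotonicity of the chain is needed. [ours] -/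
theorem integral_inv_le_mul_log {ρ : ℝ → ℝ} (hρ : ∀ t t', ρ t ≤ ρ t' + |t - t'|)
    (hpos : ∀ t, 0 < ρ t) {η : ℝ} (hη0 : 0 < η) (hη1 : η ≤ 1) {x : ℕ → ℝ} {K : ℕ}
    (h : ∀ k < K, x (k + 1) - x k ≤ (1 - η) * ρ (x k)) :
    ∫ t in x 0..x K, (ρ t)⁻¹ ≤ K * Real.log (1 / η) := by
  have hcinv : Continuous fun t => (ρ t)⁻¹ :=
    (continuous_of_le_add_abs hρ).inv₀ fun t => (hpos t).ne'
  induction K with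
  | zero => simp
  | succ K ih =>
    have hK := ih fun k hk => h k (Nat.lt_succ_of_lt hk)
    have hstep := integral_inv_le_log_of_step hρ hpos hη0 hη1 (h K (Nat.lt_succ_self K))
    rw [← intervalIntegral.integral_add_adjacent_intervals (hcinv.intervalIntegrable (x 0) (x K))
      (hcinv.intervalIntegrable (x K) (x (K + 1)))]
    push_cast
    linarith

/-! ## §3. The gauge `dist(·, F)` for a closed obstacle set `F ⊂ ℂ ∖ ℝ` (several zeros) -/

/-- From per-point bounds to the distance to the set: if `Δ ≤ (1-η)‖c - s₀‖` for every `s₀ ∈ F`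
(`F` nonempty, `η ≤ 1`) then `Δ ≤ (1-η)·infDist c F`. [ours] -/
theorem step_le_mul_infDist {F : Set ℂ} (hne : F.Nonempty) {Δ η : ℝ} (hη1 : η ≤ 1) {c : ℂ}
    (h : ∀ s₀ ∈ F, Δ ≤ (1 - η) * ‖c - s₀‖) : Δ ≤ (1 - η) * infDist c F := by
  rcases eq_or_lt_of_le (sub_nonneg.mpr hη1) with h0 | hlt
  · obtain ⟨s₀, hs₀⟩ := hne
    have := h s₀ hs₀
    rw [← h0, zero_mul] at this ⊢
    exact this
  · have hq : Δ / (1 - η) ≤ infDist c F := by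
      rw [le_infDist hne]
      intro s₀ hs₀
      rw [div_le_iff₀ hlt, dist_eq_norm, mul_comm]
      exact h s₀ hs₀
    have := mul_le_mul_of_nonneg_left hq hlt.le
    rwa [mul_div_cancel₀ _ hlt.ne'] at this

/-- The gauge `t ↦ infDist (t : ℂ) F` is 1-Lipschitz on `ℝ`. -/
theorem infDist_ofReal_le_add_abs (F : Set ℂ) (t t' : ℝ) :
    infDist (t : ℂ) F ≤ infDist (t' : ℂ) F + |t - t'| := by
  have h := infDist_le_infDist_add_dist (x := (t : ℂ)) (y := (t' : ℂ)) (s := F)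
  rwa [dist_eq_norm, ← Complex.ofReal_sub, Complex.norm_real, Real.norm_eq_abs] at h

/-- **THEOREM S, several-zeros form.** Let `F ⊂ ℂ` be closed, nonempty and without real points
(the Fisher zeros of a partition function positive on the real axis), `0 < η ≤ 1`, and let the
real chain `x` satisfy `x (k+1) - x k ≤ (1-η)‖x_k - s₀‖` for every `s₀ ∈ F` and `k < K` (for the
re-expanded flow-constant staircase this is `Staircase.step_le_of_stage_summable` of
`FisherStaircase`, one zero at a time). Then
`∫_{x₀}^{x_K} dt / dist(t, F) ≤ K · log(1/η)` — the stage count is at least the quasihyperbolic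
length of `[x₀, x_K]` in `ℂ ∖ F` over `log(1/η)`, which dominates every single-zero bound. [ours] -/
theorem integral_inv_infDist_le_mul_log {F : Set ℂ} (hF : IsClosed F) (hne : F.Nonempty)
    (hreal : ∀ t : ℝ, (t : ℂ) ∉ F) {η : ℝ} (hη0 : 0 < η) (hη1 : η ≤ 1) {x : ℕ → ℝ} {K : ℕ}
    (h : ∀ k < K, ∀ s₀ ∈ F, x (k + 1) - x k ≤ (1 - η) * ‖(x k : ℂ) - s₀‖) :
    ∫ t in x 0..x K, (infDist (t : ℂ) F)⁻¹ ≤ K * Real.log (1 / η) :=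
  integral_inv_le_mul_log (ρ := fun t : ℝ => infDist (t : ℂ) F) (infDist_ofReal_le_add_abs F)
    (fun t => (hF.notMem_iff_infDist_pos hne).1 (hreal t)) hη0 hη1
    fun k hk => step_le_mul_infDist hne hη1 (h k hk)

/-! ## §4. The single-zero length in closed form -/

/-- **`∫_a^b dt/‖t - z‖ = arsinh((b - Re z)/|Im z|) - arsinh((a - Re z)/|Im z|)`** for `Im z ≠ 0`:
the quasihyperbolic length of the real segment `[a, b]` in the punctured plane `ℂ ∖ {z}` measured
from the puncture (`‖t - z‖ = |Im z|·√(1 + ((t - Re z)/|Im z|)²)`, and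
`(arsinh u)' = 1/√(1 + u²)`). With `ρ t = ‖(t : ℂ) - z‖` in `integral_inv_le_mul_log` this is the
`arsinh` form of THEOREM S (`Staircase.arsinh_sub_arsinh_le` of `FisherStaircase`, proved there
without integrals). [ours] -/
theorem integral_inv_norm_ofReal_sub {z : ℂ} (hz : z.im ≠ 0) (a b : ℝ) :
    ∫ t in a..b, ‖(t : ℂ) - z‖⁻¹ =
      Real.arsinh ((b - z.re) / |z.im|) - Real.arsinh ((a - z.re) / |z.im|) := by
  have hm : 0 < |z.im| := abs_pos.mpr hz
  -- `‖t - z‖ = |Im z| √(1 + u²)`, `u = (t - Re z)/|Im z|`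
  have hnorm : ∀ t : ℝ, ‖(t : ℂ) - z‖ = |z.im| * Real.sqrt (1 + ((t - z.re) / |z.im|) ^ 2) := by
    intro t
    rw [← Real.sqrt_sq hm.le, ← Real.sqrt_mul (sq_nonneg _), Real.sqrt_sq hm.le,
      ← Real.sqrt_sq (norm_nonneg _), Literature.Analysis.DeBrangesSpaces.norm_ofReal_sub_sq]
    congr 1
    have : z.im ^ 2 = |z.im| ^ 2 := (sq_abs _).symm
    rw [this]
    field_simp
    ring
  have hne : ∀ t : ℝ, ‖(t : ℂ) - z‖ ≠ 0 := by
    intro t h0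
    have : ((t : ℂ) - z).im = 0 := by rw [norm_eq_zero.mp h0]; simp
    simp [hz] at this
  -- the primitive
  have hderiv : ∀ t ∈ uIcc a b,
      HasDerivAt (fun t : ℝ => Real.arsinh ((t - z.re) / |z.im|)) (‖(t : ℂ) - z‖⁻¹) t := by
    intro t _
    have hin : HasDerivAt (fun t : ℝ => (t - z.re) / |z.im|) (1 / |z.im|) t :=
      ((hasDerivAt_id t).sub_const _).div_const _
    have h := (Real.hasDerivAt_arsinh ((t - z.re) / |z.im|)).comp t hin
    have hval : (Real.sqrt (1 + ((t - z.re) / |z.im|) ^ 2))⁻¹ * (1 / |z.im|) =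
        ‖(t : ℂ) - z‖⁻¹ := by
      rw [hnorm t, mul_inv, one_div, mul_comm]
    rw [hval] at h
    exact h
  have hint : IntervalIntegrable (fun t : ℝ => ‖(t : ℂ) - z‖⁻¹) volume a b :=
    ((Complex.continuous_ofReal.sub continuous_const).norm.inv₀ hne).intervalIntegrable a b
  rw [intervalIntegral.integral_eq_sub_of_hasDerivAt hderiv hint]

end Staircase

end Summit.Ventures.LatticeQCDFlow.TrivializingMaps
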